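import Summits.HodgeConjecture.HodgeConjecture.Theorems.MotivatedLefschetzSplitLefschetzStandardBPolarizationOperator
import Summits.HodgeConjecture.HodgeConjecture.Theorems.MotivatedLefschetzSplitLefschetzStandardBTransposeDuality
import Summits.HodgeConjecture.HodgeConjecture.Theorems.MotivatedLefschetzSplitLefschetzStandardBCayleyHamiltonTransfer
import Literature.AlgebraicGeometry.HodgeTheory.HodgeRiemannPolarizabilityProofs
import Literature.AlgebraicGeometry.HodgeTheory.HodgeTypeConjugation
import Literature.AlgebraicGeometry.HodgeTheory.HodgeTypeProjectors
import Literature.AlgebraicGeometry.HodgeTheory.HodgeTypePullback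
import Literature.AlgebraicGeometry.HodgeTheory.ComplexGysinHodgeType
import Literature.AlgebraicGeometry.HodgeTheory.GysinHodgeClassLiftProofs
import Literature.AlgebraicGeometry.HodgeTheory.AlgebraicClassesHodgeTypeHolds
import Literature.AlgebraicGeometry.HodgeTheory.AbelianVarietyEndomorphismsHOne
import Literature.AlgebraicGeometry.HodgeTheory.LefschetzOneOneHolds
import Literature.AlgebraicGeometry.HodgeTheory.ComplexConjugationHolds
import HarnessLib

/-!
# Crux `LefschetzStandardB` (stmt-HodgeConjecture-17489), line `birth` — stub 3 `stub_charlesSpread`: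
# CHARLES'S SPREAD CRITERION (Charles 2013, Prop. 8, direction ⇐) on the real carriers

Route `HodgeConjecture/MotivatedLefschetzSplit`, crux #3 `LefschetzStandardB` (Grothendieck's `B(X)` for every smooth
projective complex `X`); registered skeleton `Cruxes/LefschetzStandardB/Lines/birth.lean`
(`LefschetzStandardB_of : Sig.stub_lowerHalf → Sig.stub_familySupply → Sig.stub_charlesSpread →
Sig.stub_cayleyHamiltonTransfer → LefschetzStandardB`). With stubs 1 and 4 landed
(`…LefschetzStandardBLowerHalf`, `…LefschetzStandardBCayleyHamiltonTransfer`), this file closes stub 3, so that the crux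
is REDUCED IN THE KERNEL TO ITS ONE OPEN STUB `stub_familySupply` ("`Hᵇ(Z)` is swept out by a family of
codimension-`b` algebraic cycles", Charles's geometric form of `B`).

**`stub_charlesSpread`** (signature VERBATIM): for `Z` smooth projective of dimension `d` and `a + b = 2d`, `d < a`, granted
(H) conjecture `B` in the lower half and in all target degrees `≤ b − 2` for ALL smooth projective `S` and all
polarisation classes, and a FAMILY SUPPLY (`S` smooth projective of dimension `l ≥ b`, `a' + b = 2l`, a SURJECTIVE algebraic
correspondence `T : Hᵃ'(S(ℂ); ℂ) → Hᵇ(Z(ℂ); ℂ)`), there is a BIJECTIVE algebraic self-correspondence `θ : Hᵃ(Z) → Hᵇ(Z)`.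

Proof (Charles, loc. cit., adapted to complex coefficients). Write `T = [γ]_*`, `γ ∈ Nᵇ H^{2b}((Z ⊗ S)(ℂ))` (part XXII-e of
the AbelianAll André axis normalises the orientations). Take a Kähler–rational datum `D` of `S` (`HodgeRiemannPolarizabilityProofs`):
its class `κ = D.Hη` is a polarisation class (rational, algebraic by Lefschetz `(1,1)`, hard Lefschetz), and its polarisation
form `Q = D.cform` on `Hᵇ(S(ℂ); ℂ)` satisfies the two Hodge–Riemann relations (`cform_eq_zero_of_filtration`, `cform_conj_pos`).
Set `θ := [conj γ]_* ∘ Φ ∘ [γ]^t`, where `Φ = L^{l-b} ∘ s` is the polarisation operator of part II (`Q(x, y) = τ(Φ x ∪ y)`,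
algebraic by (H) on `S` — Charles's Lemma 7) and `[γ]^t = pr_{S*}(pr_Z^* · ∪ γ)` the transpose (part III; algebraic). Then
`θ` is algebraic (compositions), and INJECTIVE: if `θ v = 0` then by the duality of part III `Q([γ]^t v, [conj γ]^t w) = 0` for
all `w`; the subspace `V = [γ]^t Hᵃ(Z)` is a sum of pure Hodge types (`γ` has type `(b,b)`, Gysin and pull-back shift
types) and `[conj γ]^t (conj w) = conj([γ]^t w)`, so testing against `w = conj v_{p,q}` and using the first Hodge–Riemann
relation (with the reality `Q(conj x, conj y) = conj Q(x, y)`) isolates `Q(y_{p,q}, conj y_{p,q}) = 0` for each type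
component `y_{p,q}` of `y = [γ]^t v`, whence `y = 0` by the second relation, and `v = 0` because `[γ]^t` is injective
(`T` surjective, perfect Poincaré pairing). Bijectivity: `dim Hᵃ(Z) = dim Hᵇ(Z)` by hard Lefschetz on `Z`. (Charles works
over `ℚ` with a cycle `Γ`; the conjugate class `conj γ` — algebraic with `γ`, `conjClass_mem_algebraicClasses` — replaces the
`ℚ`-structure, so no passage to `S^r` is needed.)

Nothing here is a case of the Hodge conjecture or of `B(X)`; no definition, no named fact, no sorry.
References: [Charles2013] F. Charles, *Remarks on the Lefschetz standard conjecture and hyperkähler varieties*, Comment.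
Math. Helv. 88 (2013) (arXiv:1002.5011), Lemma 7, Prop. 8; [VoisinHodgeI2002] §6.2.3, §6.3.2 Thm. 6.32, §7.1.2, Cor. 6.12,
§7.3.2; [Kleiman1968AlgebraicCycles] §2; [Andre1996Motifs] §1.1, §2.1; [Fulton1998] §16.1; [HatcherAT2002] §3.3 Prop. 3.38.
-/

noncomputable section

-- every declaration of this problem lives in `Summit.HodgeConjecture.HodgeConjecture.…` (summit = sub-problem)
set_option linter.dupNamespace false

open CategoryTheory AlgebraicGeometry MonoidalCategory CartesianMonoidalCategory
open Literature.AlgebraicGeometry.Motives Literature.AlgebraicGeometry.HodgeTheory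
open Literature.Geometry.Kaehler (lefschetzOperator lefschetzPow HasHardLefschetzProperty lefschetzOperator_apply)
open Literature.AlgebraicTopology.SingularHomology (singularCohomology cupProduct)
open Summit.HodgeConjecture.HodgeConjecture.Ring2.AbelianAll

namespace Summit.HodgeConjecture.HodgeConjecture.Theorems.LefschetzStandardB

variable {d l : ℕ} {Z S : SchemeOver ℂ}

/-! ## §1 Reality of the trace and of the polarisation form of a Kähler–rational datum -/

/-- `conj` fixes the image of `ℚ` in `ℂ`. [folklore] -/
theorem conj_algebraMap_rat (s : ℚ) : starRingEnd ℂ (algebraMap ℚ ℂ s) = algebraMap ℚ ℂ s := by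
  rw [eq_ratCast, map_ratCast]

/-- **The normalised trace is real**: `τ_ℂ(conj z) = conj (τ_ℂ z)` on `H^{2l}(S(ℂ); ℂ)` (the line spanned by the rational
`v₀ ⊗ 1`, which `conj` fixes). [cite: VoisinHodgeI2002, Cor. 6.12 and §7.1.2] -/
theorem cTrace_conjClass (hS : IsSmoothProjective l S) (D : KaehlerRationalDatum l S) (z : complexBetti S (2 * l)) :
    D.cTrace hS (conjClass (ComplexPoints S) (2 * l) z) = starRingEnd ℂ (D.cTrace hS z) := by
  have hz := cTopCoord_smul_self hS z
  have hconj : conjClass (ComplexPoints S) (2 * l) z =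
      (starRingEnd ℂ (cTopCoord hS z)) • ofRatClass (ComplexPoints S) (2 * l) (ratTopVec hS) := by
    conv_lhs => rw [← hz]
    rw [conjClass_smul, conjClass_ofRatClass]
  rw [KaehlerRationalDatum.cTrace, LinearMap.smul_apply, LinearMap.smul_apply, hconj, map_smul, smul_eq_mul, smul_eq_mul,
    smul_eq_mul, map_mul, conj_algebraMap_rat, cTopCoord, lineCoord_self, mul_one]

/-- **The polarisation form is real**: `Q(conj x, conj y) = conj Q(x, y)` (`κ = η ⊗ 1` is real, conjugation commutes with the
primitive parts, with `L`, with `∪`, and with the trace). [cite: VoisinHodgeI2002, Cor. 6.12 and §7.1.2] -/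
theorem cform_conjClass (hS : IsSmoothProjective l S) (D : KaehlerRationalDatum l S) {k : ℕ} (x y : complexBetti S k) :
    D.cform hS k (conjClass (ComplexPoints S) k x) (conjClass (ComplexPoints S) k y) = starRingEnd ℂ (D.cform hS k x y) := by
  rw [KaehlerRationalDatum.cform, polarizationForm_apply, polarizationForm_apply, map_sum]
  refine Finset.sum_congr rfl fun P _ ↦ ?_
  rw [← D.conjClass_primitivePart hS P x, ← D.conjClass_primitivePart hS P y]
  rcases le_or_gt P.1.1 l with ha | ha
  · obtain ⟨s, hs⟩ : ∃ s, P.1.1 + s = l := ⟨l - P.1.1, by omega⟩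
    have h2 : P.1.1 + 2 * s + P.1.1 = 2 * l := by omega
    rw [hodgeRiemannPairing_apply (D.cTrace hS) hs rfl h2, hodgeRiemannPairing_apply (D.cTrace hS) hs rfl h2, map_mul]
    have hL := map_lefschetzPowTo_of_commute (conjClassHom (ComplexPoints S)) D.conjClassHom_commute s P.1.1
      (P.1.1 + 2 * s) rfl (primitivePart D.Hη l (D.hLℂ hS) (subsingleton_of_lt hS ℂ) P x)
    simp only [conjClassHom_apply] at hL
    rw [← hL, ← conjClass_cupProduct, cTrace_conjClass]
    congr 1
    rw [map_pow, map_neg, map_one]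
  · rw [hodgeRiemannPairing_of_lt _ ha, LinearMap.zero_apply, LinearMap.zero_apply, LinearMap.zero_apply,
      LinearMap.zero_apply, map_zero]

/-- **The first Hodge–Riemann relation, both halves**: classes of `A`-types `(p₁, q₁)`, `(p₂, q₂)` in `Hᵏ(S(ℂ); ℂ)` are
`Q`-orthogonal unless `p₁ + p₂ = k` (i.e. unless `(p₂, q₂) = (q₁, p₁)`): for `p₁ + p₂ > k` by `Q(Fᵖ¹, Fᵖ²) = 0`, for
`p₁ + p₂ < k` by conjugating (`q₁ + q₂ > k`, `Q` real). [cite: VoisinHodgeI2002, §7.1.2 and Lemma 6.31] -/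
theorem cform_eq_zero_of_fst_add_fst_ne (hS : IsSmoothProjective l S) (D : KaehlerRationalDatum l S) (A : HodgeModel l S)
    {k p₁ q₁ p₂ q₂ : ℕ} (h₁ : (p₁, q₁) ∈ Finset.HasAntidiagonal.antidiagonal k)
    (h₂ : (p₂, q₂) ∈ Finset.HasAntidiagonal.antidiagonal k) {x y : complexBetti S k}
    (hx : x ∈ A.typePiece k ⟨(p₁, q₁), h₁⟩) (hy : y ∈ A.typePiece k ⟨(p₂, q₂), h₂⟩) (hne : p₁ + p₂ ≠ k) :
    D.cform hS k x y = 0 := by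
  have h₁' := Finset.HasAntidiagonal.mem_antidiagonal.1 h₁
  have h₂' := Finset.HasAntidiagonal.mem_antidiagonal.1 h₂
  rcases Nat.lt_or_gt_of_ne hne with hlt | hgt
  · -- conjugate: `conj x`, `conj y` have types `(q₁, p₁)`, `(q₂, p₂)` with `q₁ + q₂ > k`
    have hI := hodgePQ_independent_of_hodgeModel_holds
    have hcx : conjClass (ComplexPoints S) k x ∈ A.typePiece k ⟨(q₁, p₁), Finset.HasAntidiagonal.mem_antidiagonal.2 (by omega)⟩ :=
      A.mem_typePiece_of_isOfHodgeType hI hS _ ((A.isOfHodgeType_of_mem_typePiece hx).conjClass hS)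
    have hcy : conjClass (ComplexPoints S) k y ∈ A.typePiece k ⟨(q₂, p₂), Finset.HasAntidiagonal.mem_antidiagonal.2 (by omega)⟩ :=
      A.mem_typePiece_of_isOfHodgeType hI hS _ ((A.isOfHodgeType_of_mem_typePiece hy).conjClass hS)
    have h0 := D.cform_eq_zero_of_filtration hS A (by omega : k + 1 ≤ q₁ + q₂)
      (A.hodgePQ_le_hodgeFiltration (by omega : q₁ + p₁ = k) le_rfl hcx)
      (A.hodgePQ_le_hodgeFiltration (by omega : q₂ + p₂ = k) le_rfl hcy)
    rw [cform_conjClass] at h0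
    exact (map_eq_zero_iff _ (starRingEnd ℂ).injective).1 h0
  · exact D.cform_eq_zero_of_filtration hS A (by omega : k + 1 ≤ p₁ + p₂)
      (A.hodgePQ_le_hodgeFiltration h₁' le_rfl hx) (A.hodgePQ_le_hodgeFiltration h₂' le_rfl hy)

/-! ## §2 Hodge types along the transpose action `w ↦ pr_{S*}(pr_Z^* w ∪ δ)` -/

section TypeShift

variable (hZ : IsSmoothProjective d Z) (hS : IsSmoothProjective l S)

/-- **The transpose action shifts Hodge types by `(e − d, e − d)`**: for `δ` of type `(e, e)` on `Z ⊗ S` and `w` of type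
`(p, q)` on `Z` with `p' + d = p + e`, `q' + d = q + e`, the class `pr_{S*}(pr_Z^* w ∪ δ)` is of type `(p', q')` on `S`
(pull-back preserves types, cup product adds them, the Gysin map of `pr_S` lowers them by `(d, d)`; Voisin I §7.3.2).
[cite: VoisinHodgeI2002, §7.3.2 (with Lemma 7.30) and §7.1.2] -/
theorem isOfHodgeType_transposeAction {e a bS : ℕ} (h₂ : a + 2 * e + 2 * l = bS + 2 * (d + l))
    {δ : complexBetti (Z ⊗ S) (2 * e)} (hδ : IsOfHodgeType (d + l) (Z ⊗ S) (2 * e) e e δ) {p q p' q' : ℕ}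
    (hp : p' + d = p + e) (hq : q' + d = q + e) {w : complexBetti Z a} (hw : IsOfHodgeType d Z a p q w) :
    IsOfHodgeType l S bS p' q'
      (complexGysin complexOrientationFamily (hZ.tensor_holds hS) hS (snd Z S) h₂
        (cupProduct rfl (complexBetti.map (fst Z S) a w) δ)) := by
  have hI := hodgePQ_independent_of_hodgeModel_holds
  have hZS := hZ.tensor_holds hS
  obtain ⟨C⟩ := (nonempty_hodgeModel_holds (n := d + l) (X := Z ⊗ S)).nonempty hZS
  have hfw : IsOfHodgeType (d + l) (Z ⊗ S) a p q (complexBetti.map (fst Z S) a w) :=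
    IsOfHodgeType.map_of_independent hI hw hZS hZ C (fst Z S)
  have hcup : IsOfHodgeType (d + l) (Z ⊗ S) (a + 2 * e) (p + e) (q + e)
      (cupProduct rfl (complexBetti.map (fst Z S) a w) δ) :=
    cupPreservesHodgeType_of_hodgeModel hZS C rfl hfw hδ
  exact isOfHodgeType_complexGysin hI (fun _ _ ↦ nonempty_hodgeModel_holds)
    (fun E _ _ _ ↦ Literature.NumberTheory.Transcendental.exists_deRhamIsoFamily_holds E) complexOrientationFamily hZS hS
    (snd Z S) h₂ (by omega) (by omega) hcup

/-- **… and kills the types that cannot be shifted**: if `p + e < d` or `q + e < d` then `pr_{S*}(pr_Z^* w ∪ δ) = 0`.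
[cite: VoisinHodgeI2002, §7.3.2 (with Lemma 7.30)] -/
theorem transposeAction_eq_zero_of_lt {e a bS : ℕ} (h₂ : a + 2 * e + 2 * l = bS + 2 * (d + l))
    {δ : complexBetti (Z ⊗ S) (2 * e)} (hδ : IsOfHodgeType (d + l) (Z ⊗ S) (2 * e) e e δ) {p q : ℕ}
    (hlt : p + e < d ∨ q + e < d) {w : complexBetti Z a} (hw : IsOfHodgeType d Z a p q w) :
    complexGysin complexOrientationFamily (hZ.tensor_holds hS) hS (snd Z S) h₂
        (cupProduct rfl (complexBetti.map (fst Z S) a w) δ) = 0 := by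
  have hI := hodgePQ_independent_of_hodgeModel_holds
  have hZS := hZ.tensor_holds hS
  obtain ⟨C⟩ := (nonempty_hodgeModel_holds (n := d + l) (X := Z ⊗ S)).nonempty hZS
  obtain ⟨A⟩ := (nonempty_hodgeModel_holds (n := l) (X := S)).nonempty hS
  have hfw : IsOfHodgeType (d + l) (Z ⊗ S) a p q (complexBetti.map (fst Z S) a w) :=
    IsOfHodgeType.map_of_independent hI hw hZS hZ C (fst Z S)
  have hcup : IsOfHodgeType (d + l) (Z ⊗ S) (a + 2 * e) (p + e) (q + e)
      (cupProduct rfl (complexBetti.map (fst Z S) a w) δ) :=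
    cupPreservesHodgeType_of_hodgeModel hZS C rfl hfw hδ
  exact complexGysin_eq_zero_of_hodgeType_of_lt hI complexOrientationFamily hZS hS C A
    (cupPreservesHodgeType_of_hodgeModel hZS C) (cupPreservesHodgeType_of_hodgeModel hS A) (snd Z S) h₂
    (by omega) ((hI.isOfHodgeType_iff hZS C).1 hcup)

end TypeShift

/-! ## §3 The Hodge–Riemann non-degeneracy on the image of the transpose -/

/-- **Hodge–Riemann non-degeneracy on `V = [γ]^t Hᵃ(Z)`.** Let `γ ∈ Nᵉ H^{2e}((Z ⊗ S)(ℂ))` be algebraic, `D` a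
Kähler–rational datum of `S`, `v ∈ Hᵃ(Z(ℂ))`, `y = [γ]^t v = pr_{S*}(pr_Z^* v ∪ γ) ∈ H^{b_S}(S(ℂ))`. If
`Q(y, [conj γ]^t w) = 0` for every `w ∈ Hᵃ(Z(ℂ))` (`Q = D.cform`), then `y = 0`: decomposing `v = ∑ v_{p,q}` into `B`-types,
`y = ∑ y_{p,q}` with `y_{p,q} = [γ]^t v_{p,q}` of pure type (or `0`); testing against `w = conj v_{p,q}`,
`[conj γ]^t (conj v_{p,q}) = conj y_{p,q}`, and the first Hodge–Riemann relation kills all cross terms, so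
`Q(y_{p,q}, conj y_{p,q}) = 0`, whence `y_{p,q} = 0` by the second. [cite: VoisinHodgeI2002, §6.3.2 Thm. 6.32 and §7.1.2]
[cite: Charles2013, proof of Prop. 8 (arXiv:1002.5011)] -/
theorem transposeAction_eq_zero_of_cform_orthogonal (hZ : IsSmoothProjective d Z) (hS : IsSmoothProjective l S)
    (D : KaehlerRationalDatum l S) {e a bS : ℕ} (h₂ : a + 2 * e + 2 * l = bS + 2 * (d + l))
    {γ : complexBetti (Z ⊗ S) (2 * e)} (hγ : γ ∈ algebraicClasses (Z ⊗ S) e) (v : complexBetti Z a)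
    (horth : ∀ w : complexBetti Z a,
      D.cform hS bS
        (complexGysin complexOrientationFamily (hZ.tensor_holds hS) hS (snd Z S) h₂
          (cupProduct rfl (complexBetti.map (fst Z S) a v) γ))
        (complexGysin complexOrientationFamily (hZ.tensor_holds hS) hS (snd Z S) h₂
          (cupProduct rfl (complexBetti.map (fst Z S) a w) (conjClass (ComplexPoints (Z ⊗ S)) (2 * e) γ))) = 0) :
    complexGysin complexOrientationFamily (hZ.tensor_holds hS) hS (snd Z S) h₂
        (cupProduct rfl (complexBetti.map (fst Z S) a v) γ) = 0 := by
  classical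
  have hI := hodgePQ_independent_of_hodgeModel_holds
  have hZS := hZ.tensor_holds hS
  obtain ⟨B⟩ := (nonempty_hodgeModel_holds (n := d) (X := Z)).nonempty hZ
  obtain ⟨A⟩ := (nonempty_hodgeModel_holds (n := l) (X := S)).nonempty hS
  have hγT : IsOfHodgeType (d + l) (Z ⊗ S) (2 * e) e e γ :=
    isOfHodgeType_of_mem_algebraicClasses_of_isSmoothProjective hZS e hγ
  -- the transpose as a linear map `F`
  set F : complexBetti Z a →ₗ[ℂ] complexBetti S bS :=
    complexGysin complexOrientationFamily hZS hS (snd Z S) h₂ ∘ₗ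
      (cupProduct (rfl : a + 2 * e = a + 2 * e)).flip γ ∘ₗ (complexBetti.map (fst Z S) a).hom with hFdef
  have hF : ∀ w, F w = complexGysin complexOrientationFamily hZS hS (snd Z S) h₂
      (cupProduct rfl (complexBetti.map (fst Z S) a w) γ) := fun w ↦ rfl
  change F v = 0
  -- type components of `v` and their images
  set vc : ↥(Finset.HasAntidiagonal.antidiagonal a) → complexBetti Z a := fun pq ↦ B.typeProj a pq v with hvc
  have hvsum : ∑ pq, vc pq = v := B.sum_typeProj a v
  have hvT : ∀ pq : ↥(Finset.HasAntidiagonal.antidiagonal a), IsOfHodgeType d Z a pq.1.1 pq.1.2 (vc pq) :=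
    fun pq ↦ B.isOfHodgeType_of_mem_typePiece (B.typeProj_mem a pq v)
  -- each image `F (v_{p,q})` vanishes
  have hzero : ∀ pq : ↥(Finset.HasAntidiagonal.antidiagonal a), F (vc pq) = 0 := by
    intro pq
    have hpq := Finset.HasAntidiagonal.mem_antidiagonal.1 pq.2
    by_cases hlt : pq.1.1 + e < d ∨ pq.1.2 + e < d
    · rw [hF]; exact transposeAction_eq_zero_of_lt hZ hS h₂ hγT hlt (hvT pq)
    push Not at hlt
    obtain ⟨p', hp'⟩ : ∃ p', p' + d = pq.1.1 + e := ⟨pq.1.1 + e - d, by omega⟩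
    obtain ⟨q', hq'⟩ : ∃ q', q' + d = pq.1.2 + e := ⟨pq.1.2 + e - d, by omega⟩
    have hp'q' : (p', q') ∈ Finset.HasAntidiagonal.antidiagonal bS :=
      Finset.HasAntidiagonal.mem_antidiagonal.2 (by omega)
    -- `y₀ = F v_{pq}` has type `(p', q')`, and `conj y₀ = [conj γ]^t (conj v_{pq})`
    have hy₀T : F (vc pq) ∈ A.typePiece bS ⟨(p', q'), hp'q'⟩ := by
      rw [hF]
      exact A.mem_typePiece_of_isOfHodgeType hI hS hp'q' (isOfHodgeType_transposeAction hZ hS h₂ hγT hp' hq' (hvT pq))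
    have hconj : complexGysin complexOrientationFamily hZS hS (snd Z S) h₂
        (cupProduct rfl (complexBetti.map (fst Z S) a (conjClass (ComplexPoints Z) a (vc pq)))
          (conjClass (ComplexPoints (Z ⊗ S)) (2 * e) γ)) = conjClass (ComplexPoints S) bS (F (vc pq)) := by
      rw [hF, conjClass_transposeAction hZ hS]
    -- test against `w = conj v_{pq}`
    have h0 := horth (conjClass (ComplexPoints Z) a (vc pq))
    have hFv : complexGysin complexOrientationFamily hZS hS (snd Z S) h₂
        (cupProduct rfl (complexBetti.map (fst Z S) a v) γ) = F v := rfl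
    rw [hFv, hconj, ← hvsum, map_sum, map_sum, LinearMap.sum_apply] at h0
    -- only the term `pq` survives
    rw [Finset.sum_eq_single pq] at h0
    · -- second Hodge–Riemann relation
      by_contra hne
      obtain ⟨r, hr, hreq⟩ := D.cform_conj_pos hS A hp'q' hy₀T hne
      rw [h0, mul_zero] at hreq
      exact hr.ne' (by exact_mod_cast hreq.symm)
    · intro pq₂ _ hne₂
      have hpq₂ := Finset.HasAntidiagonal.mem_antidiagonal.1 pq₂.2
      by_cases hlt₂ : pq₂.1.1 + e < d ∨ pq₂.1.2 + e < d
      · have hz : F (vc pq₂) = 0 := by rw [hF]; exact transposeAction_eq_zero_of_lt hZ hS h₂ hγT hlt₂ (hvT pq₂)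
        rw [hz, map_zero, LinearMap.zero_apply]
      push Not at hlt₂
      obtain ⟨p₂, hp₂⟩ : ∃ p₂, p₂ + d = pq₂.1.1 + e := ⟨pq₂.1.1 + e - d, by omega⟩
      obtain ⟨q₂, hq₂⟩ : ∃ q₂, q₂ + d = pq₂.1.2 + e := ⟨pq₂.1.2 + e - d, by omega⟩
      have hp₂q₂ : (p₂, q₂) ∈ Finset.HasAntidiagonal.antidiagonal bS :=
        Finset.HasAntidiagonal.mem_antidiagonal.2 (by omega)
      have hy₂T : F (vc pq₂) ∈ A.typePiece bS ⟨(p₂, q₂), hp₂q₂⟩ := by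
        rw [hF]
        exact A.mem_typePiece_of_isOfHodgeType hI hS hp₂q₂ (isOfHodgeType_transposeAction hZ hS h₂ hγT hp₂ hq₂ (hvT pq₂))
      have hcy₀ : conjClass (ComplexPoints S) bS (F (vc pq)) ∈
          A.typePiece bS ⟨(q', p'), Finset.HasAntidiagonal.mem_antidiagonal.2 (by omega)⟩ :=
        A.mem_typePiece_of_isOfHodgeType hI hS _ ((A.isOfHodgeType_of_mem_typePiece hy₀T).conjClass hS)
      refine cform_eq_zero_of_fst_add_fst_ne hS D A hp₂q₂ _ hy₂T hcy₀ fun heq ↦ hne₂ ?_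
      -- `p₂ + q' = bS` forces `pq₂ = pq`
      apply Subtype.ext
      exact Prod.ext (by omega) (by omega)
    · intro h; exact absurd (Finset.mem_univ pq) h
  rw [← hvsum, map_sum]
  exact Finset.sum_eq_zero fun pq _ ↦ hzero pq

/-! ## §4 Charles's spread: the bijective algebraic self-correspondence -/

/-- **Charles 2013, Prop. 8 (⇐), on the real carriers.** For `Z` smooth projective of dimension `d`, degrees `b + j = d`,
`a = b + 2j` with `j ≥ 1`; granted `B(S)` (for one polarisation class `κ` of `S` coming from a Kähler–rational datum) in the
target degrees `≤ b − 2` on the parameter variety `S` (dimension `l ≥ b`) of a SURJECTIVE algebraic correspondence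
`T : H^{2l-b}(S(ℂ)) → Hᵇ(Z(ℂ))`: there is a bijective algebraic correspondence `θ : Hᵃ(Z(ℂ); ℂ) → Hᵇ(Z(ℂ); ℂ)`, namely
`θ = [conj γ]_* ∘ Φ ∘ [γ]^t` for `T = [γ]_*`. [cite: Charles2013, Prop. 8 with Lemma 7 (arXiv:1002.5011)]
[cite: VoisinHodgeI2002, §6.3.2 Thm. 6.32 and §7.1.2] [cite: Kleiman1968AlgebraicCycles, §2] -/
theorem exists_bijective_algebraicCorrespondence_of_surjective (hZ : IsSmoothProjective d Z) (hS : IsSmoothProjective l S)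
    (D : KaehlerRationalDatum l S) (hκ : IsPolarizationClass l S D.Hη) {b j a' : ℕ} (hj : b + (j + 1) = d) (hbl : b ≤ l)
    (ha' : a' + b = 2 * l)
    (hBS : ∀ (a₁ b₁ : ℕ) (hab₁ : a₁ + b₁ = 2 * l), b₁ + 2 ≤ b →
      IsAlgebraicCorrespondence l l S S (lefschetzInvolution hκ.hasHardLefschetz hab₁))
    {γ : complexBetti (Z ⊗ S) (2 * b)} (hγ : γ ∈ algebraicClasses (Z ⊗ S) b) (h₁ : a' + 2 * b = b + 2 * l)
    (hsurj : Function.Surjective (corrAction complexOrientationFamily hZ hS h₁ γ)) :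
    ∃ θ : complexBetti Z (b + 2 * (j + 1)) →ₗ[ℂ] complexBetti Z b, Function.Bijective θ ∧ IsAlgebraicCorrespondence d d Z Z θ := by
  have hZS := hZ.tensor_holds hS
  have hvan := subsingleton_of_lt hS ℂ
  have h₂ : b + 2 * (j + 1) + 2 * b + 2 * l = b + 2 * (d + l) := by omega
  -- the three factors
  set Tt : complexBetti Z (b + 2 * (j + 1)) →ₗ[ℂ] complexBetti S b :=
    complexGysin complexOrientationFamily hZS hS (snd Z S) h₂ ∘ₗ
      (cupProduct (rfl : b + 2 * (j + 1) + 2 * b = b + 2 * (j + 1) + 2 * b)).flip γ ∘ₗ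
        (complexBetti.map (fst Z S) (b + 2 * (j + 1))).hom with hTtdef
  have hTt : ∀ w, Tt w = complexGysin complexOrientationFamily hZS hS (snd Z S) h₂
      (cupProduct rfl (complexBetti.map (fst Z S) (b + 2 * (j + 1)) w) γ) := fun w ↦ rfl
  set Φ : complexBetti S b →ₗ[ℂ] complexBetti S a' :=
    ∑ p : {p : ℕ × ℕ // p.1 + 2 * p.2 = b},
      ((-1 : ℂ) ^ (p.1.1 * (p.1.1 - 1) / 2)) •
        (lefschetzPowTo D.Hη (l - p.1.1 - p.1.2) p.1.1 a' (by have := p.2; omega) ∘ₗ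
          primitivePart D.Hη l hκ.hasHardLefschetz hvan p) with hΦdef
  set γc := conjClass (ComplexPoints (Z ⊗ S)) (2 * b) γ with hγcdef
  have hγc : γc ∈ algebraicClasses (Z ⊗ S) b := conjClass_mem_algebraicClasses hZS hγ
  set Tc := corrAction complexOrientationFamily hZ hS h₁ γc with hTcdef
  have hθv : ∀ v, ((Tc ∘ₗ Φ) ∘ₗ Tt) v = corrAction complexOrientationFamily hZ hS h₁ γc (Φ (Tt v)) := fun _ ↦ rfl
  -- `Q(x, y) = τ(Φ x ∪ y)`
  have hΦform : ∀ x y : complexBetti S b, D.cform hS b x y = D.cTrace hS (cupProduct ha' (Φ x) y) := fun x y ↦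
    polarizationForm_eq_trace_cup_sum (D.hasHardLefschetzProperty hS) hvan (D.cTrace hS) hbl ha' x y
  -- algebraicity
  have hTtalg : IsAlgebraicCorrespondence l d S Z Tt := isAlgebraicCorrespondence_transposeAction hZ hS h₂ (by omega) hγ
  have hΦalg : IsAlgebraicCorrespondence l l S S Φ := isAlgebraicCorrespondence_polarizationOperator hS hκ hvan hbl ha' hBS
  have hTcalg : IsAlgebraicCorrespondence d l Z S Tc := isAlgebraicCorrespondence_corrAction_complex hZ hS h₁ (by omega) hγc
  have hθalg : IsAlgebraicCorrespondence d d Z Z ((Tc ∘ₗ Φ) ∘ₗ Tt) :=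
    IsAlgebraicCorrespondence.comp hZ hS hZ hTtalg (IsAlgebraicCorrespondence.comp hZ hS hS hΦalg hTcalg (by omega)) (by omega)
  -- from here on the three factors are used through the recorded equations only
  set θ : complexBetti Z (b + 2 * (j + 1)) →ₗ[ℂ] complexBetti Z b := (Tc ∘ₗ Φ) ∘ₗ Tt with hθdef
  clear_value θ Tc Φ Tt
  -- injectivity
  have hinj : Function.Injective θ := by
    rw [injective_iff_map_eq_zero]
    intro v hv
    have hy : Tt v = 0 := by
      rw [hTt]
      refine transposeAction_eq_zero_of_cform_orthogonal hZ hS D h₂ hγ v fun w ↦ ?_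
      rw [← hTt, hΦform]
      have hdual := (cup_corrAction_eq_zero_iff hZ hS h₁ (by omega : b + (b + 2 * (j + 1)) = 2 * d) h₂ ha' γc (Φ (Tt v)) w).1
        (by rw [← hθv, hv, LinearMap.map_zero₂])
      rw [hdual, map_zero]
    refine transpose_injective_of_surjective hZ hS h₁ (by omega : b + (b + 2 * (j + 1)) = 2 * d) h₂ ha' γ hsurj ?_
    rw [← hTt, hy]
  -- bijectivity by dimension count (hard Lefschetz on `Z`)
  obtain ⟨DZ⟩ := nonempty_kaehlerRationalDatum hZ
  haveI := finite_complexBetti_of_smoothProjective hZ b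
  haveI := finite_complexBetti_of_smoothProjective hZ (b + 2 * (j + 1))
  have hdim : Module.finrank ℂ (complexBetti Z (b + 2 * (j + 1))) = Module.finrank ℂ (complexBetti Z b) :=
    (LinearEquiv.ofBijective (lefschetzPow DZ.Hη (j + 1) b) (DZ.hasHardLefschetzProperty hZ (j + 1) b hj)).finrank_eq.symm
  have hsurjθ : Function.Surjective θ := (LinearMap.injective_iff_surjective_of_finrank_eq_finrank hdim).1 hinj
  exact ⟨θ, ⟨hinj, hsurjθ⟩, hθalg⟩

/-- **Stub 3 of crux `LefschetzStandardB` — Charles's spread criterion (registered signature, verbatim).** For `Z` smooth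
projective of dimension `d` and `a + b = 2d`, `d < a`: granted conjecture `B` in the lower half and in all target degrees
`≤ b − 2` for ALL smooth projective complex varieties and all polarisation classes, and a family supply (`S` smooth projective of
dimension `l ≥ b` with a SURJECTIVE algebraic correspondence `T : H^{2l-b}(S(ℂ); ℂ) → Hᵇ(Z(ℂ); ℂ)`), there is a BIJECTIVE
algebraic self-correspondence `θ : Hᵃ(Z(ℂ); ℂ) → Hᵇ(Z(ℂ); ℂ)` — `θ = [conj γ]_* ∘ L^{l-b} ∘ s ∘ [γ]^t` for `T = [γ]_*` and a
Kähler–rational polarisation of `S`, injective by the Hodge index argument on the sub-Hodge structure `[γ]^t Hᵃ(Z)`.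
[cite: Charles2013, Prop. 8 with Lemma 7 (arXiv:1002.5011)] [cite: VoisinHodgeI2002, §6.3.2 Thm. 6.32 and §7.1.2]
[cite: Kleiman1968AlgebraicCycles, §2] -/
theorem stub_charlesSpread :
    ∀ (d : ℕ) (Z : SchemeOver ℂ), IsSmoothProjective d Z →
      ∀ (a b : ℕ), a + b = 2 * d → d < a →
        (∀ (l : ℕ) (S : SchemeOver ℂ) (κ : complexBetti S 2), IsSmoothProjective l S →
          ∀ (hκ : IsPolarizationClass l S κ) (a' b' : ℕ) (hab' : a' + b' = 2 * l),
            a' ≤ l ∨ b' + 2 ≤ b →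
            IsAlgebraicCorrespondence l l S S (lefschetzInvolution hκ.hasHardLefschetz hab')) →
        (∃ (l : ℕ) (S : SchemeOver ℂ) (_ : IsSmoothProjective l S) (a' : ℕ) (_ : a' + b = 2 * l)
          (_ : b ≤ l) (T : complexBetti S a' →ₗ[ℂ] complexBetti Z b),
          Function.Surjective T ∧ IsAlgebraicCorrespondence d l Z S T) →
        ∃ θ : complexBetti Z a →ₗ[ℂ] complexBetti Z b,
          Function.Bijective θ ∧ IsAlgebraicCorrespondence d d Z Z θ := by
  intro d Z hZ a b hab hda hB hsupply
  obtain ⟨l, S, hS, a', ha', hbl, T, hTsurj, hTalg⟩ := hsupply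
  obtain ⟨e, h₁, γ, hγ, rfl⟩ := IsAlgebraicCorrespondence.exists_eq_corrAction hZ hS hTalg
  obtain rfl : b = e := by omega
  obtain ⟨j, hj⟩ : ∃ j, b + (j + 1) = d := ⟨d - b - 1, by omega⟩
  obtain rfl : a = b + 2 * (j + 1) := by omega
  obtain ⟨D⟩ := nonempty_kaehlerRationalDatum hS
  have hκ : IsPolarizationClass l S D.Hη :=
    ⟨D.isRationalClass_Hη, lefschetzOneOne_rational_holds hS D.Hη D.isRationalClass_Hη D.isOfHodgeType_Hη,
      D.hasHardLefschetzProperty hS⟩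
  exact exists_bijective_algebraicCorrespondence_of_surjective hZ hS D hκ hj hbl ha'
    (fun a₁ b₁ hab₁ hb₁ ↦ hB l S D.Hη hS hκ a₁ b₁ hab₁ (Or.inr hb₁)) hγ h₁ hTsurj

end Summit.HodgeConjecture.HodgeConjecture.Theorems.LefschetzStandardB

end
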